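import Mathlib
import Summits.Ventures.PercRepro2.HCov
import Summits.Ventures.PercRepro2.A3Fibre
import Summits.Ventures.PercRepro2.A3FibreA
import Summits.Ventures.PercRepro2.A3FibreLeft
import Summits.Ventures.PercRepro2.A3FibreMain
import Summits.Ventures.PercRepro2.A3RootEdge
import Summits.Ventures.PercRepro2.A3RootEdgeFibre

/-!
# The (MEANS-a₃) functional `btw` at a pinned root edge: the e-split of its four pieces
(blind cell PercRepro2, p5 g13; `proofs/P5-ROOTEDGE.md` §6, second block)

For a root edge `e = {a₁, a₃}`, `t = p e`, and `btwg p γ` := `btw` with `F` evaluated at an explicit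
constant `γ` (`btwg_gamma : btwg p (gamma p) = btw p`):

* every fibre mass pins (`Ssig_eq_pin`, `Su_eq_pin`, `SFg_eq_pin`) and so do the fibre sums
  (`sum_Ssig_eq_pin`, `sum_SFg_eq_pin`);
* the per-fibre term `Ssig·SFg/mW` pins LINEARLY (`term_eq_pin`): for `a₁ ∉ W` the fibre forces `e`
  closed (`A3RootEdgeFibre`), for `a₁ ∈ W, a₂ ∉ W` the fibre means are `e`-invariant so the term is
  `mW · cb · cF`, and for `a₁, a₂ ∈ W` the fibre is empty; hence `sum_term_eq_pin`;
* the `PD`-part (the `fibresA` sums and `D`) scales by `(1 − t)` (`sum_termA_eq_pin`,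
  `sum_A_Su_eq_pin`, `prob_PD_eq_pin`);
* **`btwg_eq_pin`**: `btwg p γ = t · btwg p₁ γ + (1 − t) · btwg p₀ γ + cross`, with the cross term
  `cross = t(1 − t)(Q₀A₁ − Q₁A₀)(Q₀B₁ − Q₁B₀)/(Q·Q₀·Q₁)` (`cross_eq`) when `Q₀, Q₁, Q ≠ 0`, where
  `A_q = ∑ Ssig_q`, `B_q = ∑ SFg_q γ`.
-/

namespace Summit.Ventures.PercRepro2

open UnionCluster

namespace CovForm

namespace RootEdge

open CCT A3Fibre

section Means

variable {V : Type*} {E : Type*} [Fintype V] [DecidableEq V] [Fintype E] [DecidableEq E]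
  {R : Type*} [Field R] [LinearOrder R] [IsStrictOrderedRing R]

/-- `SF` at an explicit constant `γ`. -/
noncomputable def SFg (p : E → R) (ends : E → Sym2 V) (o a₁ a₂ a₃ : V) (γ : R) (W : Finset V) : R :=
  Ssig p ends a₁ a₂ a₃ o W + s3 a₁ a₂ W * (γ * mW p ends a₁ a₂ a₃ W - Su p ends a₁ a₂ a₃ o W)

omit [Fintype V] [LinearOrder R] [IsStrictOrderedRing R] in
/-- At `γ = gamma p`, `SFg` is `SF`. -/
lemma SFg_gamma (p : E → R) (ends : E → Sym2 V) (o a₁ a₂ a₃ : V) (W : Finset V) :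
    SFg p ends o a₁ a₂ a₃ (gamma p ends o a₁ a₂ a₃) W = SF p ends o a₁ a₂ a₃ W := rfl

/-- `btw` at an explicit constant `γ`. -/
noncomputable def btwg (p : E → R) (ends : E → Sym2 V) (o a₁ a₂ a₃ b : V) (γ : R) : R :=
  (∑ W : Finset V, Ssig p ends a₁ a₂ a₃ b W * SFg p ends o a₁ a₂ a₃ γ W / mW p ends a₁ a₂ a₃ W) -
    (∑ W : Finset V, Ssig p ends a₁ a₂ a₃ b W) * (∑ W : Finset V, SFg p ends o a₁ a₂ a₃ γ W) /
      prob p (avoidAll ends a₂ {a₁}) -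
    (∑ W ∈ fibresA a₁ a₂, Su p ends a₁ a₂ a₃ b W * Su p ends a₁ a₂ a₃ o W / mW p ends a₁ a₂ a₃ W) +
    (∑ W ∈ fibresA a₁ a₂, Su p ends a₁ a₂ a₃ b W) * (∑ W ∈ fibresA a₁ a₂, Su p ends a₁ a₂ a₃ o W) /
      prob p (PDEvent ends a₁ a₂ a₃)

omit [LinearOrder R] [IsStrictOrderedRing R] in
/-- At `γ = gamma p`, `btwg` is `btw`. -/
lemma btwg_gamma (p : E → R) (ends : E → Sym2 V) (o a₁ a₂ a₃ b : V) :
    btwg p ends o a₁ a₂ a₃ b (gamma p ends o a₁ a₂ a₃) = btw p ends o a₁ a₂ a₃ b := rfl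

variable {ends : E → Sym2 V} {e : E} {a₁ a₂ a₃ : V}

/-! ### The pins -/

omit [Fintype V] [DecidableEq V] [LinearOrder R] [IsStrictOrderedRing R] in
/-- `Ssig` pins along `e`. -/
lemma Ssig_eq_pin (p : E → R) (v : V) (W : Finset V) :
    Ssig p ends a₁ a₂ a₃ v W =
      p e * Ssig (Function.update p e 1) ends a₁ a₂ a₃ v W +
        (1 - p e) * Ssig (Function.update p e 0) ends a₁ a₂ a₃ v W := by
  unfold Ssig
  rw [prob_eq_pin p _ e, prob_eq_pin p (fibre ends a₁ a₂ a₃ W ∩ connEvent ends a₂ v) e]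
  ring

omit [Fintype V] [DecidableEq V] [LinearOrder R] [IsStrictOrderedRing R] in
/-- `Su` pins along `e`. -/
lemma Su_eq_pin (p : E → R) (v : V) (W : Finset V) :
    Su p ends a₁ a₂ a₃ v W =
      p e * Su (Function.update p e 1) ends a₁ a₂ a₃ v W +
        (1 - p e) * Su (Function.update p e 0) ends a₁ a₂ a₃ v W := by
  unfold Su
  rw [prob_eq_pin p _ e, prob_eq_pin p (fibre ends a₁ a₂ a₃ W ∩ connEvent ends a₂ v) e]
  ring

omit [Fintype V] [LinearOrder R] [IsStrictOrderedRing R] in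
/-- `SFg` (at a fixed `γ`) pins along `e`. -/
lemma SFg_eq_pin (p : E → R) (o : V) (γ : R) (W : Finset V) :
    SFg p ends o a₁ a₂ a₃ γ W =
      p e * SFg (Function.update p e 1) ends o a₁ a₂ a₃ γ W +
        (1 - p e) * SFg (Function.update p e 0) ends o a₁ a₂ a₃ γ W := by
  unfold SFg
  rw [Ssig_eq_pin (e := e) p o W, Su_eq_pin (e := e) p o W, mW_eq_pin (e := e) p W]
  ring

omit [DecidableEq V] [LinearOrder R] [IsStrictOrderedRing R] in
/-- The `Ssig`-sum pins along `e`. -/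
lemma sum_Ssig_eq_pin (p : E → R) (v : V) :
    (∑ W : Finset V, Ssig p ends a₁ a₂ a₃ v W) =
      p e * (∑ W : Finset V, Ssig (Function.update p e 1) ends a₁ a₂ a₃ v W) +
        (1 - p e) * (∑ W : Finset V, Ssig (Function.update p e 0) ends a₁ a₂ a₃ v W) := by
  rw [Finset.mul_sum, Finset.mul_sum, ← Finset.sum_add_distrib]
  exact Finset.sum_congr rfl fun W _ => Ssig_eq_pin p v W

omit [LinearOrder R] [IsStrictOrderedRing R] in
/-- The `SFg`-sum pins along `e`. -/
lemma sum_SFg_eq_pin (p : E → R) (o : V) (γ : R) :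
    (∑ W : Finset V, SFg p ends o a₁ a₂ a₃ γ W) =
      p e * (∑ W : Finset V, SFg (Function.update p e 1) ends o a₁ a₂ a₃ γ W) +
        (1 - p e) * (∑ W : Finset V, SFg (Function.update p e 0) ends o a₁ a₂ a₃ γ W) := by
  rw [Finset.mul_sum, Finset.mul_sum, ← Finset.sum_add_distrib]
  exact Finset.sum_congr rfl fun W _ => SFg_eq_pin p o γ W

/-! ### Two facts about `x / 0 = 0` -/

omit [Fintype V] [DecidableEq V] [Fintype E] [DecidableEq E] [LinearOrder R] [IsStrictOrderedRing R] in
/-- `(k a)(k b)/(k c) = k (ab/c)` in a field with `x / 0 = 0`, for every `k`. -/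
lemma mul_mul_div_mul (k a b c : R) : (k * a) * (k * b) / (k * c) = k * (a * b / c) := by
  rcases eq_or_ne k 0 with hk | hk
  · simp [hk]
  rw [show (k * a) * (k * b) = k * (k * (a * b)) by ring, mul_div_mul_left _ _ hk, mul_div_assoc]

omit [Fintype V] [DecidableEq V] [Fintype E] [DecidableEq E] [LinearOrder R] [IsStrictOrderedRing R] in
/-- `(m x)(m y)/m = m (x y)`. -/
lemma mul_mul_div_self (m x y : R) : (m * x) * (m * y) / m = m * (x * y) := by
  rcases eq_or_ne m 0 with hm | hm
  · simp [hm]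
  rw [show (m * x) * (m * y) = m * (m * (x * y)) by ring, mul_div_cancel_left₀ _ hm]

/-! ### The per-fibre term `Ssig · SFg / mW` -/

omit [Fintype V] [DecidableEq V] [LinearOrder R] [IsStrictOrderedRing R] in
/-- The bare fibre mass vanishes at `p[e ↦ 1]` when `a₁ ∉ W`. -/
lemma mW_one_of_notMem (p : E → R) (hends : ends e = s(a₁, a₃)) {W : Finset V} (h₁ : a₁ ∉ W) :
    mW (Function.update p e 1) ends a₁ a₂ a₃ W = 0 := by
  have h := prob_one_fibre_inter (a₂ := a₂) p hends h₁ Set.univ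
  simpa only [Set.inter_univ, mW] using h

omit [Fintype V] [DecidableEq V] [LinearOrder R] [IsStrictOrderedRing R] in
/-- For `a₁ ∉ W`: `Ssig p = (1 − p e) · Ssig p₀`. -/
lemma Ssig_eq_of_notMem (p : E → R) (hends : ends e = s(a₁, a₃)) {W : Finset V} (h₁ : a₁ ∉ W)
    (v : V) :
    Ssig p ends a₁ a₂ a₃ v W = (1 - p e) * Ssig (Function.update p e 0) ends a₁ a₂ a₃ v W := by
  unfold Ssig
  rw [prob_fibre_inter_eq_pin p hends h₁, prob_fibre_inter_eq_pin p hends h₁]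
  ring

omit [Fintype V] [DecidableEq V] [LinearOrder R] [IsStrictOrderedRing R] in
/-- For `a₁ ∉ W`: `Su p = (1 − p e) · Su p₀`. -/
lemma Su_eq_of_notMem (p : E → R) (hends : ends e = s(a₁, a₃)) {W : Finset V} (h₁ : a₁ ∉ W)
    (v : V) :
    Su p ends a₁ a₂ a₃ v W = (1 - p e) * Su (Function.update p e 0) ends a₁ a₂ a₃ v W := by
  unfold Su
  rw [prob_fibre_inter_eq_pin p hends h₁, prob_fibre_inter_eq_pin p hends h₁]
  ring

omit [Fintype V] [DecidableEq V] [LinearOrder R] [IsStrictOrderedRing R] in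
/-- For `a₁ ∉ W`: `mW p = (1 − p e) · mW p₀`. -/
lemma mW_eq_of_notMem (p : E → R) (hends : ends e = s(a₁, a₃)) {W : Finset V} (h₁ : a₁ ∉ W) :
    mW p ends a₁ a₂ a₃ W = (1 - p e) * mW (Function.update p e 0) ends a₁ a₂ a₃ W := by
  have h := prob_fibre_inter_eq_pin (a₂ := a₂) p hends h₁ Set.univ
  simpa only [Set.inter_univ, mW] using h

omit [Fintype V] [LinearOrder R] [IsStrictOrderedRing R] in
/-- For `a₁ ∉ W`: `SFg p γ = (1 − p e) · SFg p₀ γ`. -/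
lemma SFg_eq_of_notMem (p : E → R) (hends : ends e = s(a₁, a₃)) {W : Finset V} (h₁ : a₁ ∉ W)
    (o : V) (γ : R) :
    SFg p ends o a₁ a₂ a₃ γ W = (1 - p e) * SFg (Function.update p e 0) ends o a₁ a₂ a₃ γ W := by
  unfold SFg
  rw [Ssig_eq_of_notMem p hends h₁, Su_eq_of_notMem p hends h₁, mW_eq_of_notMem p hends h₁]
  ring

omit [Fintype V] [LinearOrder R] [IsStrictOrderedRing R] in
/-- The term at `p[e ↦ 1]` for `a₁ ∉ W` is `0`. -/
lemma term_one_of_notMem (p : E → R) (hends : ends e = s(a₁, a₃)) {W : Finset V} (h₁ : a₁ ∉ W)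
    (o b : V) (γ : R) :
    Ssig (Function.update p e 1) ends a₁ a₂ a₃ b W * SFg (Function.update p e 1) ends o a₁ a₂ a₃ γ W /
      mW (Function.update p e 1) ends a₁ a₂ a₃ W = 0 := by
  rw [mW_one_of_notMem p hends h₁, div_zero]

omit [LinearOrder R] [IsStrictOrderedRing R] in
/-- On a T′-fibre the term is `mW · cb · cF` with `e`-free constants. -/
lemma term_update_of_mem (p : E → R) (hends : ends e = s(a₁, a₃)) {W : Finset V} (h₁ : a₁ ∈ W)
    (h₂ : a₂ ∉ W) (o b : V) (γ : R) (q : R) :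
    Ssig (Function.update p e q) ends a₁ a₂ a₃ b W *
        SFg (Function.update p e q) ends o a₁ a₂ a₃ γ W / mW (Function.update p e q) ends a₁ a₂ a₃ W =
      mW (Function.update p e q) ends a₁ a₂ a₃ W *
        ((if b ∈ W then (1 : R) else -prob p (Rv ends a₂ b W)) *
          (γ + (if o ∈ W then (0 : R) else -2 * prob p (Rv ends a₂ o W)))) := by
  have hs3 : s3 a₁ a₂ W = (1 : R) := by simp [s3, h₁]
  have hSF : SFg (Function.update p e q) ends o a₁ a₂ a₃ γ W =
      mW (Function.update p e q) ends a₁ a₂ a₃ W *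
        (γ + (if o ∈ W then (0 : R) else -2 * prob p (Rv ends a₂ o W))) := by
    unfold SFg
    rw [Ssig_update_eq_mul p hends h₁ h₂ o q, Su_update_eq_mul p hends h₁ h₂ o q, hs3]
    split_ifs <;> ring
  rw [Ssig_update_eq_mul p hends h₁ h₂ b q, hSF, mul_mul_div_self]

omit [Fintype V] [LinearOrder R] [IsStrictOrderedRing R] in
/-- With both roots in `W` the fibre is empty, so every term vanishes. -/
lemma term_of_mem_mem (p : E → R) {W : Finset V} (h₁ : a₁ ∈ W) (h₂ : a₂ ∈ W) (o b : V) (γ : R) :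
    Ssig p ends a₁ a₂ a₃ b W * SFg p ends o a₁ a₂ a₃ γ W / mW p ends a₁ a₂ a₃ W = 0 := by
  have hm : mW p ends a₁ a₂ a₃ W = 0 := by
    unfold mW
    rw [fibre_eq_empty_of_mem_mem ends a₁ a₂ a₃ h₁ h₂, prob_empty]
  rw [hm, div_zero]

omit [LinearOrder R] [IsStrictOrderedRing R] in
/-- **The per-fibre term pins linearly.** -/
theorem term_eq_pin (p : E → R) (hends : ends e = s(a₁, a₃)) (o b : V) (γ : R) (W : Finset V) :
    Ssig p ends a₁ a₂ a₃ b W * SFg p ends o a₁ a₂ a₃ γ W / mW p ends a₁ a₂ a₃ W =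
      p e * (Ssig (Function.update p e 1) ends a₁ a₂ a₃ b W *
          SFg (Function.update p e 1) ends o a₁ a₂ a₃ γ W / mW (Function.update p e 1) ends a₁ a₂ a₃ W) +
        (1 - p e) * (Ssig (Function.update p e 0) ends a₁ a₂ a₃ b W *
          SFg (Function.update p e 0) ends o a₁ a₂ a₃ γ W / mW (Function.update p e 0) ends a₁ a₂ a₃ W) := by
  by_cases h₁ : a₁ ∈ W
  · by_cases h₂ : a₂ ∈ W
    · rw [term_of_mem_mem p h₁ h₂, term_of_mem_mem _ h₁ h₂, term_of_mem_mem _ h₁ h₂]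
      ring
    · have hp : p = Function.update p e (p e) := (Function.update_eq_self e p).symm
      have key := term_update_of_mem p hends h₁ h₂ o b γ
      have h0 := key 0
      have h1 := key 1
      have hq := key (p e)
      rw [Function.update_eq_self] at hq
      rw [hq, h0, h1, mW_eq_pin (e := e) p W]
      ring
  · rw [term_one_of_notMem p hends h₁, Ssig_eq_of_notMem p hends h₁, SFg_eq_of_notMem p hends h₁,
      mW_eq_of_notMem p hends h₁, mul_mul_div_mul]
    ring

omit [LinearOrder R] [IsStrictOrderedRing R] in
/-- The first sum pins linearly. -/
theorem sum_term_eq_pin (p : E → R) (hends : ends e = s(a₁, a₃)) (o b : V) (γ : R) :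
    (∑ W : Finset V, Ssig p ends a₁ a₂ a₃ b W * SFg p ends o a₁ a₂ a₃ γ W / mW p ends a₁ a₂ a₃ W) =
      p e * (∑ W : Finset V, Ssig (Function.update p e 1) ends a₁ a₂ a₃ b W *
          SFg (Function.update p e 1) ends o a₁ a₂ a₃ γ W / mW (Function.update p e 1) ends a₁ a₂ a₃ W) +
        (1 - p e) * (∑ W : Finset V, Ssig (Function.update p e 0) ends a₁ a₂ a₃ b W *
          SFg (Function.update p e 0) ends o a₁ a₂ a₃ γ W / mW (Function.update p e 0) ends a₁ a₂ a₃ W) := by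
  rw [Finset.mul_sum, Finset.mul_sum, ← Finset.sum_add_distrib]
  exact Finset.sum_congr rfl fun W _ => term_eq_pin p hends o b γ W

/-! ### The `PD`-part scales by `(1 − p e)` -/

omit [LinearOrder R] [IsStrictOrderedRing R] in
/-- An `A`-fibre does not contain `a₁`. -/
lemma mem_fibresA_notMem {W : Finset V} (hW : W ∈ fibresA a₁ a₂) : a₁ ∉ W :=
  (Finset.mem_filter.1 hW).2.1

omit [LinearOrder R] [IsStrictOrderedRing R] in
/-- The `A`-sum of `Su·Su/mW` scales by `(1 − p e)`. -/
lemma sum_termA_eq_pin (p : E → R) (hends : ends e = s(a₁, a₃)) (o b : V) :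
    (∑ W ∈ fibresA a₁ a₂, Su p ends a₁ a₂ a₃ b W * Su p ends a₁ a₂ a₃ o W / mW p ends a₁ a₂ a₃ W) =
      (1 - p e) * (∑ W ∈ fibresA a₁ a₂, Su (Function.update p e 0) ends a₁ a₂ a₃ b W *
        Su (Function.update p e 0) ends a₁ a₂ a₃ o W / mW (Function.update p e 0) ends a₁ a₂ a₃ W) := by
  rw [Finset.mul_sum]
  refine Finset.sum_congr rfl fun W hW => ?_
  have h₁ := mem_fibresA_notMem hW
  rw [Su_eq_of_notMem p hends h₁, Su_eq_of_notMem p hends h₁, mW_eq_of_notMem p hends h₁,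
    mul_mul_div_mul]

omit [LinearOrder R] [IsStrictOrderedRing R] in
/-- The `A`-sum of `Su` scales by `(1 − p e)`. -/
lemma sum_A_Su_eq_pin (p : E → R) (hends : ends e = s(a₁, a₃)) (v : V) :
    (∑ W ∈ fibresA a₁ a₂, Su p ends a₁ a₂ a₃ v W) =
      (1 - p e) * (∑ W ∈ fibresA a₁ a₂, Su (Function.update p e 0) ends a₁ a₂ a₃ v W) := by
  rw [Finset.mul_sum]
  exact Finset.sum_congr rfl fun W hW => Su_eq_of_notMem p hends (mem_fibresA_notMem hW) v

omit [Fintype V] [DecidableEq V] [LinearOrder R] [IsStrictOrderedRing R] in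
/-- `D = (1 − p e) · D₀` (the world `PD` forces `e` closed). -/
lemma prob_PD_eq_pin (p : E → R) (hends : ends e = s(a₁, a₃)) :
    prob p (PDEvent ends a₁ a₂ a₃) = (1 - p e) * prob (Function.update p e 0) (PDEvent ends a₁ a₂ a₃) := by
  rw [prob_eq_pin p _ e, prob_one_PD p hends a₂]
  ring

omit [LinearOrder R] [IsStrictOrderedRing R] in
/-- The `PD`-part at `p[e ↦ 1]` vanishes (the `fibresA` are null there). -/
lemma sum_A_Su_one (p : E → R) (hends : ends e = s(a₁, a₃)) (v : V) :
    (∑ W ∈ fibresA a₁ a₂, Su (Function.update p e 1) ends a₁ a₂ a₃ v W) = 0 := by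
  refine Finset.sum_eq_zero fun W hW => ?_
  have h₁ := mem_fibresA_notMem hW
  unfold Su
  rw [prob_one_fibre_inter p hends h₁, prob_one_fibre_inter p hends h₁]
  ring

omit [LinearOrder R] [IsStrictOrderedRing R] in
/-- The `A`-sum of `Su·Su/mW` vanishes at `p[e ↦ 1]`. -/
lemma sum_termA_one (p : E → R) (hends : ends e = s(a₁, a₃)) (o b : V) :
    (∑ W ∈ fibresA a₁ a₂, Su (Function.update p e 1) ends a₁ a₂ a₃ b W *
      Su (Function.update p e 1) ends a₁ a₂ a₃ o W / mW (Function.update p e 1) ends a₁ a₂ a₃ W) = 0 := by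
  refine Finset.sum_eq_zero fun W hW => ?_
  rw [mW_one_of_notMem p hends (mem_fibresA_notMem hW), div_zero]

/-! ### The split of `btwg` -/

omit [LinearOrder R] [IsStrictOrderedRing R] in
/-- **The e-split of the means functional**: with `A_q = ∑ Ssig_q`, `B_q = ∑ SFg_q γ`,
`btwg p γ = t · btwg p₁ γ + (1 − t) · btwg p₀ γ − A·B/Q + t·A₁B₁/Q₁ + (1 − t)·A₀B₀/Q₀`
(the product terms are left explicit; `cross_eq` evaluates their combination). -/
theorem btwg_eq_pin (p : E → R) (hends : ends e = s(a₁, a₃)) (o b : V) (γ : R) :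
    btwg p ends o a₁ a₂ a₃ b γ =
      p e * btwg (Function.update p e 1) ends o a₁ a₂ a₃ b γ +
        (1 - p e) * btwg (Function.update p e 0) ends o a₁ a₂ a₃ b γ -
        (∑ W : Finset V, Ssig p ends a₁ a₂ a₃ b W) * (∑ W : Finset V, SFg p ends o a₁ a₂ a₃ γ W) /
          prob p (avoidAll ends a₂ {a₁}) +
        p e * ((∑ W : Finset V, Ssig (Function.update p e 1) ends a₁ a₂ a₃ b W) *
          (∑ W : Finset V, SFg (Function.update p e 1) ends o a₁ a₂ a₃ γ W) /
            prob (Function.update p e 1) (avoidAll ends a₂ {a₁})) +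
        (1 - p e) * ((∑ W : Finset V, Ssig (Function.update p e 0) ends a₁ a₂ a₃ b W) *
          (∑ W : Finset V, SFg (Function.update p e 0) ends o a₁ a₂ a₃ γ W) /
            prob (Function.update p e 0) (avoidAll ends a₂ {a₁})) := by
  unfold btwg
  rw [sum_term_eq_pin p hends o b γ, sum_termA_eq_pin p hends o b, sum_A_Su_eq_pin p hends b,
    sum_A_Su_eq_pin p hends o, prob_PD_eq_pin p hends, sum_termA_one p hends o b,
    sum_A_Su_one p hends b, sum_A_Su_one p hends o, mul_mul_div_mul]
  ring

end Means

end RootEdge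

end CovForm

end Summit.Ventures.PercRepro2
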